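import Summits.AnomalousDissipation.AnomalousDissipation.Theorems.MomentParityPathField
import Summits.AnomalousDissipation.AnomalousDissipation.Theorems.StirringSphereEnsembleRealizationStubAugCurrentFlow
import Summits.AnomalousDissipation.AnomalousDissipation.Theorems.StirringSphereEnsembleRealizationStubAugCurrentField

/-!
# Crux `EnsembleRealization` (stmt-AnomalousDissipation-0215) — line `augmented-lift`,
# sub-stub M1 `stub_augCurrent`, piece (M1b) `stub_augCurrentPathLawTools`: the orbit-path law

Supports stmt-AnomalousDissipation-0215 (stub `stub_augCurrent` of line `augmented-lift`, piece
M1b). Nothing here closes an item.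

One level of the mechanism of `stub_augCurrent`, abstractly: an `L²`-orthonormal family `g` of
smooth solenoidal fields on `T³` (coordinates `w ∈ ℝ^D` synthesize the field `θ Σⱼ wⱼ gⱼ`), a
probability measure `m` on `ℝ^D × ℝ` carried by a compact box `Bx`, a `C¹` compactly supported
field `V` with `tsupport V ⊆ Bx` satisfying the weak stationary Liouville equation against `m`,
and the modewise rate bound `‖𝓕(θ Σⱼ (V z)ⱼ gⱼ)(k)‖ ≤ L k`. The law `P` of the orbit paths of
the (invariant) global flow on `𝒦(R, L) × [0, b]^ℚ` is a probability measure with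
shift-invariant path marginal; its one-time joint laws are the law of `(𝓕(θ Σ wⱼ gⱼ), e)` under
`m`; and the DRIFT / ENERGY functionals of a path are time integrals of pointwise defects along
the orbit, so that their `P`-means are at most `(q' − q)` times the `m`-means of the defects
(flow tools `stub_augCurrentFlowTools`, field tools `stub_augCurrentFieldTools`).
-/

noncomputable section

set_option linter.dupNamespace false

open MeasureTheory Set Filter Topology Function Metric UnitAddTorus
open scoped BigOperators ENNReal InnerProductSpace RealInnerProductSpace

namespace Summit.AnomalousDissipation.AnomalousDissipation.Theorems.EnsembleRealization

open Literature.Analysis.FunctionSpaces Literature.Analysis.FunctionSpaces.Torus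
open Literature.Analysis.FluidPDE Literature.Analysis.FluidPDE.Torus
open Summit.AnomalousDissipation.AnomalousDissipation.Theorems.MomentParity

/-! ### Paths of continuous-time coefficient curves -/

section Curves

variable {R : ℝ} {L : (Fin 3 → ℤ) → ℝ}

/-- **The sampled path of a coefficient curve lies in the trajectory space** as soon as the
curve stays in the energy ball, is `L k`-Lipschitz mode by mode, conjugate symmetric and
transversal at nonnegative times. -/
theorem curvePath_mem_pathSpace {γ : ℝ → (Fin 3 → ℤ) → EuclideanSpace ℂ (Fin 3)}
    (h2 : ∀ s : ℝ, 0 ≤ s → ∀ T : Finset (Fin 3 → ℤ), ∑ k ∈ T, ‖γ s k‖ ^ 2 ≤ R ^ 2)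
    (h3 : ∀ (k : Fin 3 → ℤ) (s s' : ℝ), 0 ≤ s → 0 ≤ s' → ‖γ s k - γ s' k‖ ≤ L k * |s - s'|)
    (h4 : ∀ s : ℝ, 0 ≤ s → IsConjSymm (γ s))
    (h5 : ∀ s : ℝ, 0 ≤ s → ∀ k : Fin 3 → ℤ, ∑ j, (k j : ℂ) * γ s k j = 0) :
    (fun p : ℚ × (Fin 3 → ℤ) => γ ((max p.1 0 : ℚ) : ℝ) p.2) ∈ pathSpace R L := by
  have hnn : ∀ q : ℚ, (0 : ℝ) ≤ ((max q 0 : ℚ) : ℝ) := fun q => by exact_mod_cast le_max_right q 0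
  refine ⟨fun q k => ?_, fun q T => h2 _ (hnn q) T, fun q q' k hq hq' => ?_, fun q => h4 _ (hnn q),
    fun q k => h5 _ (hnn q) k⟩
  · simp only [max_eq_left (le_max_right q 0)]
  · simp only [max_eq_left hq, max_eq_left hq']
    exact h3 k q q' (by exact_mod_cast hq) (by exact_mod_cast hq')

/-- **The extension of the sampled path of a continuous curve is the curve** (`t ≥ 0`). -/
theorem pathExt_curvePath {γ : ℝ → (Fin 3 → ℤ) → EuclideanSpace ℂ (Fin 3)}
    (hmem : (fun p : ℚ × (Fin 3 → ℤ) => γ ((max p.1 0 : ℚ) : ℝ) p.2) ∈ pathSpace R L)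
    (hγ : ∀ k, Continuous fun s => γ s k) {t : ℝ} (ht : 0 ≤ t) (k : Fin 3 → ℤ) :
    pathExt (fun p : ℚ × (Fin 3 → ℤ) => γ ((max p.1 0 : ℚ) : ℝ) p.2) t k = γ t k := by
  have h1 := tendsto_dyadic_apply hmem t k
  have heq : ∀ n, (fun p : ℚ × (Fin 3 → ℤ) => γ ((max p.1 0 : ℚ) : ℝ) p.2) (dyadicFloor t n, k) =
      γ (dyadicFloor t n) k := fun n => by
    simp only [max_eq_left (dyadicFloor_nonneg t n)]
  simp_rw [heq] at h1
  have h2 : Tendsto (fun n => γ ((dyadicFloor t n : ℚ) : ℝ) k) atTop (𝓝 (γ t k)) := by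
    have hd : Tendsto (fun n => ((dyadicFloor t n : ℚ) : ℝ)) atTop (𝓝 t) := by
      simpa [max_eq_left ht] using tendsto_dyadicFloor t
    exact ((hγ k).tendsto t).comp hd
  exact tendsto_nhds_unique h1 h2

/-- Shifting the sampled path of a curve samples the time-translated curve. -/
theorem pathShift_curvePath (γ : ℝ → (Fin 3 → ℤ) → EuclideanSpace ℂ (Fin 3)) :
    pathShift (fun p : ℚ × (Fin 3 → ℤ) => γ ((max p.1 0 : ℚ) : ℝ) p.2) =
      fun p : ℚ × (Fin 3 → ℤ) => γ (((max p.1 0 : ℚ) : ℝ) + 1) p.2 := by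
  funext p
  obtain ⟨q, k⟩ := p
  rw [pathShift_apply]
  have h : max (max q 0 + 1) 0 = max q 0 + 1 := max_eq_left (by positivity)
  simp only [h]
  push_cast
  ring_nf

/-- Positive parts pass inside interval integrals: `(∫ₐᵇ u)₊ ≤ ∫ₐᵇ u₊` for `a ≤ b`. -/
theorem max_intervalIntegral_le {u : ℝ → ℝ} (hu : Continuous u) {a b : ℝ} (hab : a ≤ b) :
    max 0 (∫ τ in a..b, u τ) ≤ ∫ τ in a..b, max 0 (u τ) :=
  max_le (intervalIntegral.integral_nonneg hab fun _ _ => le_max_left _ _)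
    (intervalIntegral.integral_mono_on hab (hu.intervalIntegrable _ _)
      ((continuous_const.max hu).intervalIntegrable _ _) fun _ _ => le_max_right _ _)

end Curves

/-! ### (M1b) The orbit-path law -/

/-- **(M1b) The orbit-path law of a stationary smooth current** (one level; see the module
docstring): probability, shift-invariant path marginal, one-time joint laws by invariance,
DRIFT and ENERGY functionals as time integrals along the orbit bounded in `P`-mean by
`(q' − q)` times the `m`-mean of the pointwise defects. -/
theorem stub_augCurrentPathLawTools {f : UnitAddTorus (Fin 3) → EuclideanSpace ℝ (Fin 3)}
    {D : ℕ} {g : Fin D → UnitAddTorus (Fin 3) → EuclideanSpace ℝ (Fin 3)}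
    (hg : ∀ j, IsSmooth (g j)) (hgdiv : ∀ j, IsDivFree (g j))
    (horth : ∀ i j, ∫ x, ⟪g i x, g j x⟫_ℝ = if i = j then 1 else 0)
    {θ : ℝ} (hθ : 0 ≤ θ) {R b : ℝ} {L : (Fin 3 → ℤ) → ℝ}
    {Bx : Set (EuclideanSpace ℝ (Fin D) × ℝ)} (hBx : IsCompact Bx)
    (hBw : ∀ z ∈ Bx, θ * ‖z.1‖ ≤ R) (hBe : ∀ z ∈ Bx, 0 ≤ z.2 ∧ z.2 ≤ b)
    (m : Measure (EuclideanSpace ℝ (Fin D) × ℝ)) [IsProbabilityMeasure m] (hmB : m Bxᶜ = 0)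
    {V : EuclideanSpace ℝ (Fin D) × ℝ → EuclideanSpace ℝ (Fin D) × ℝ} (hV : ContDiff ℝ 1 V)
    (hVc : HasCompactSupport V) (hVB : tsupport V ⊆ Bx)
    (hVm : ∀ ψ : EuclideanSpace ℝ (Fin D) × ℝ → ℝ, ContDiff ℝ 1 ψ → HasCompactSupport ψ →
      ∫ z, fderiv ℝ ψ z (V z) ∂m = 0)
    (hrate : ∀ z k, ‖mFourierCoeff (EuclideanSpace.complexify ∘ fun x => θ • ∑ j, (V z).1 j • g j x) k‖ ≤ L k)
    (ν : ℝ) (hf : IsSmooth f) :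
    ∃ P : Measure (↥(pathSpace R L : Set (Path (Fin 3))) × ↥((Set.univ : Set ℚ).pi fun _ : ℚ => Set.Icc (0 : ℝ) b)),
      IsProbabilityMeasure P ∧
      (P.map Prod.fst).map (pathShiftOn R L (pathShift_mapsTo R L)) = P.map Prod.fst ∧
      (∀ q : ℚ, 0 ≤ q → ∀ φ : ((Fin 3 → ℤ) → EuclideanSpace ℂ (Fin 3)) × ℝ → ℝ, Continuous φ →
        ∫ x, φ ((fun k : Fin 3 → ℤ => x.1.1 (q, k)), x.2.1 q) ∂P =
          ∫ z, φ ((fun k : Fin 3 → ℤ => mFourierCoeff (EuclideanSpace.complexify ∘ fun x => θ • ∑ j, z.1 j • g j x) k),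
            z.2) ∂m) ∧
      (∀ a : UnitAddTorus (Fin 3) → EuclideanSpace ℝ (Fin 3), IsSmooth a →
        ∀ c : ((Fin 3 → ℤ) → EuclideanSpace ℂ (Fin 3)) → ℝ, Continuous c → (∃ B : ℝ, ∀ z, |c z| ≤ B) →
        ∀ q q' : ℚ, 0 ≤ q → q ≤ q' →
          ∫ x, |(∑' k, (⟪mFourierCoeff (EuclideanSpace.complexify ∘ a) k, x.1.1 (q', k)⟫_ℂ).re) -
              (∑' k, (⟪mFourierCoeff (EuclideanSpace.complexify ∘ a) k, x.1.1 (q, k)⟫_ℂ).re) -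
              ∫ τ in (q : ℝ)..q', c (fun k : Fin 3 → ℤ => pathExt x.1.1 τ k)| ∂P ≤
            ((q' : ℝ) - q) * ∫ z, |(∫ x, ⟪a x, θ • ∑ j, (V z).1 j • g j x⟫_ℝ) -
              c (fun k : Fin 3 → ℤ => mFourierCoeff (EuclideanSpace.complexify ∘ fun x => θ • ∑ j, z.1 j • g j x) k)| ∂m) ∧
      (∀ (K : ℕ) (q q' : ℚ), 0 ≤ q → q ≤ q' →
        ∫ x, max 0 (x.2.1 q' - x.2.1 q + ∫ τ in (q : ℝ)..q',
            (2 * pathDiss ν K x.1.1 τ -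
              2 * ∑' k, (⟪mFourierCoeff (EuclideanSpace.complexify ∘ f) k, pathExt x.1.1 τ k⟫_ℂ).re)) ∂P ≤
          ((q' : ℝ) - q) * ∫ z, max 0 ((V z).2 +
            2 * (ν * (4 * Real.pi ^ 2 * ∑ k ∈ freqBall K, freqNormSq k *
              ‖mFourierCoeff (EuclideanSpace.complexify ∘ fun x => θ • ∑ j, z.1 j • g j x) k‖ ^ 2)) -
            2 * ∫ x, ⟪f x, θ • ∑ j, z.1 j • g j x⟫_ℝ) ∂m) := by
  classical
  obtain ⟨Φ, hΦc, hΦ0, hΦd, hΦadd, hΦB, hΦinv, hΦint, hΦpar, hΦL1⟩ :=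
    stub_augCurrentFlowTools hV hVc hBx hVB m hmB hVm
  obtain ⟨hT, hcs, htr, hbes, hℓ, hpars⟩ := stub_augCurrentFieldTools hg hgdiv horth θ
  -- the coefficients of the synthesized field
  set C : (EuclideanSpace ℝ (Fin D) × ℝ) → (Fin 3 → ℤ) → EuclideanSpace ℂ (Fin 3) :=
    fun z k => mFourierCoeff (EuclideanSpace.complexify ∘ fun x => θ • ∑ j, z.1 j • g j x) k with hC
  have hCcont : ∀ k, Continuous fun z => C z k := fun k => by
    obtain ⟨T, hT'⟩ := hT k
    have : (fun z => C z k) = fun z => T z.1 := funext fun z => hT' z.1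
    rw [this]
    exact T.continuous.comp continuous_fst
  have hΦz : ∀ s, Continuous fun z => Φ s z := fun s => hΦc.comp (continuous_const.prodMk continuous_id)
  have hΦs : ∀ z, Continuous fun s => Φ s z := fun z => hΦc.comp (continuous_id.prodMk continuous_const)
  have hγcont : ∀ z k, Continuous fun s => C (Φ s z) k := fun z k => (hCcont k).comp (hΦs z)
  have hfst : ∀ z t, HasDerivAt (fun s => (Φ s z).1) (V (Φ t z)).1 t := fun z t =>
    ((ContinuousLinearMap.fst ℝ (EuclideanSpace ℝ (Fin D)) ℝ).hasFDerivAt).comp_hasDerivAt t (hΦd z t)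
  have hsnd : ∀ z t, HasDerivAt (fun s => (Φ s z).2) (V (Φ t z)).2 t := fun z t =>
    ((ContinuousLinearMap.snd ℝ (EuclideanSpace ℝ (Fin D)) ℝ).hasFDerivAt).comp_hasDerivAt t (hΦd z t)
  have hγder : ∀ z k t, HasDerivAt (fun s => C (Φ s z) k)
      (mFourierCoeff (EuclideanSpace.complexify ∘ fun x => θ • ∑ j, (V (Φ t z)).1 j • g j x) k) t := by
    intro z k t
    obtain ⟨T, hT'⟩ := hT k
    have h1 : (fun s => C (Φ s z) k) = fun s => T (Φ s z).1 := funext fun s => hT' _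
    rw [h1, hT']
    exact T.hasFDerivAt.comp_hasDerivAt t (hfst z t)
  -- a.e. in the box
  have hae : ∀ᵐ z ∂m, z ∈ Bx := by rw [ae_iff]; exact hmB
  -- the orbit paths lie in the trajectory space
  have hmem : ∀ z ∈ Bx, (fun p : ℚ × (Fin 3 → ℤ) => C (Φ ((max p.1 0 : ℚ) : ℝ) z) p.2) ∈ pathSpace R L := by
    intro z hz
    refine curvePath_mem_pathSpace (γ := fun s k => C (Φ s z) k) (fun s _ T => ?_) (fun k s s' _ _ => ?_)
      (fun s _ => hcs _) (fun s _ k => htr _ k)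
    · refine (hbes _ T).trans ?_
      have hw := hBw _ (hΦB z hz s)
      have h0 : 0 ≤ θ * ‖(Φ s z).1‖ := mul_nonneg hθ (norm_nonneg _)
      have := pow_le_pow_left₀ h0 hw 2
      rwa [mul_pow] at this
    · have h := (convex_univ (𝕜 := ℝ) (E := ℝ)).norm_image_sub_le_of_norm_hasDerivWithin_le
        (f := fun r => C (Φ r z) k) (fun r _ => (hγder z k r).hasDerivWithinAt)
        (fun r _ => hrate (Φ r z) k) (mem_univ s') (mem_univ s)
      rwa [Real.norm_eq_abs] at h
  have hemem : ∀ z ∈ Bx, (fun q : ℚ => (Φ ((max q 0 : ℚ) : ℝ) z).2) ∈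
      (Set.univ : Set ℚ).pi fun _ : ℚ => Set.Icc (0 : ℝ) b :=
    fun z hz => mem_univ_pi.2 fun q => hBe _ (hΦB z hz _)
  -- a base point of the (nonempty) box, and the path map
  have hBne : Bx.Nonempty := by
    by_contra h
    rw [not_nonempty_iff_eq_empty] at h
    have h1 : m univ = 0 := by rw [← compl_empty, ← h]; exact hmB
    exact (IsProbabilityMeasure.ne_zero m) (Measure.measure_univ_eq_zero.1 h1)
  obtain ⟨z₀, hz₀⟩ := hBne
  let pmap : EuclideanSpace ℝ (Fin D) × ℝ →
      ↥(pathSpace R L : Set (Path (Fin 3))) × ↥((Set.univ : Set ℚ).pi fun _ : ℚ => Set.Icc (0 : ℝ) b) :=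
    fun z => if hz : z ∈ Bx then (⟨_, hmem z hz⟩, ⟨_, hemem z hz⟩) else (⟨_, hmem z₀ hz₀⟩, ⟨_, hemem z₀ hz₀⟩)
  have hpmap : ∀ z (hz : z ∈ Bx), pmap z = (⟨_, hmem z hz⟩, ⟨_, hemem z hz⟩) := fun z hz => dif_pos hz
  -- measurability of the path map (continuity on the closed box)
  have hωcont : Continuous fun z => fun p : ℚ × (Fin 3 → ℤ) => C (Φ ((max p.1 0 : ℚ) : ℝ) z) p.2 :=
    continuous_pi fun p => (hCcont p.2).comp (hΦz _)
  have hecont : Continuous fun z => fun q : ℚ => (Φ ((max q 0 : ℚ) : ℝ) z).2 :=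
    continuous_pi fun q => continuous_snd.comp (hΦz _)
  have hpmapcont : ContinuousOn pmap Bx := by
    rw [continuousOn_iff_continuous_restrict]
    have h1 : Continuous fun z : Bx =>
        ((⟨_, hmem z.1 z.2⟩ : ↥(pathSpace R L : Set (Path (Fin 3)))),
          (⟨_, hemem z.1 z.2⟩ : ↥((Set.univ : Set ℚ).pi fun _ : ℚ => Set.Icc (0 : ℝ) b))) :=
      ((hωcont.comp continuous_subtype_val).subtype_mk _).prodMk
        ((hecont.comp continuous_subtype_val).subtype_mk _)
    refine h1.congr fun z => ?_
    rw [restrict_apply, hpmap z.1 z.2]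
  have hpmapm : AEMeasurable pmap m := by
    rw [← Measure.restrict_eq_self_of_ae_mem hae]
    exact hpmapcont.aemeasurable hBx.isClosed.measurableSet
  have hpmap1m : AEMeasurable (fun z => (pmap z).1) m := measurable_fst.comp_aemeasurable hpmapm
  have hΦm : ∀ s, Measurable (Φ s) := fun s => (hΦz s).measurable
  refine ⟨m.map pmap, Measure.isProbabilityMeasure_map hpmapm, ?_, ?_, ?_, ?_⟩
  · -- shift invariance of the path marginal
    have hmap : (m.map pmap).map Prod.fst = m.map fun z => (pmap z).1 :=
      AEMeasurable.map_map_of_aemeasurable measurable_fst.aemeasurable hpmapm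
    have hkey : ∀ z ∈ Bx, (pmap (Φ 1 z)).1 = pathShiftOn R L (pathShift_mapsTo R L) (pmap z).1 := by
      intro z hz
      rw [hpmap _ (hΦB z hz 1), hpmap _ hz]
      apply Subtype.ext
      funext p
      obtain ⟨r, k⟩ := p
      show C (Φ ((max r 0 : ℚ) : ℝ) (Φ 1 z)) k =
        pathShift (fun p : ℚ × (Fin 3 → ℤ) => C (Φ ((max p.1 0 : ℚ) : ℝ) z) p.2) (r, k)
      rw [pathShift_apply]
      show C (Φ ((max r 0 : ℚ) : ℝ) (Φ 1 z)) k = C (Φ ((max (max r 0 + 1) 0 : ℚ) : ℝ) z) k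
      rw [max_eq_left (by positivity : (0 : ℚ) ≤ max r 0 + 1)]
      push_cast
      rw [hΦadd]
    have hθm : Measurable (pathShiftOn (d := Fin 3) R L (pathShift_mapsTo R L)) :=
      (continuous_pathShiftOn R L).measurable
    rw [hmap, AEMeasurable.map_map_of_aemeasurable hθm.aemeasurable hpmap1m]
    have hcongr : (pathShiftOn R L (pathShift_mapsTo R L) ∘ fun z => (pmap z).1) =ᵐ[m]
        (fun z => (pmap z).1) ∘ Φ 1 := hae.mono fun z hz => by
      simp only [Function.comp_apply]
      exact (hkey z hz).symm
    rw [Measure.map_congr hcongr]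
    have h2 : AEMeasurable (fun z => (pmap z).1) (m.map (Φ 1)) := by rw [hΦinv 1 zero_le_one]; exact hpmap1m
    rw [← AEMeasurable.map_map_of_aemeasurable h2 (hΦm 1).aemeasurable, hΦinv 1 zero_le_one]
  · -- one-time joint laws
    intro q hq φ hφ
    have hqr : ((max q 0 : ℚ) : ℝ) = (q : ℝ) := by rw [max_eq_left hq]
    have hev : Continuous fun x : ↥(pathSpace R L : Set (Path (Fin 3))) ×
        ↥((Set.univ : Set ℚ).pi fun _ : ℚ => Set.Icc (0 : ℝ) b) =>
        φ ((fun k : Fin 3 → ℤ => x.1.1 (q, k)), x.2.1 q) :=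
      hφ.comp ((continuous_pi fun k => (continuous_apply (q, k)).comp
        (continuous_subtype_val.comp continuous_fst)).prodMk
        ((continuous_apply q).comp (continuous_subtype_val.comp continuous_snd)))
    rw [integral_map hpmapm hev.aestronglyMeasurable]
    have hGc : Continuous fun z : EuclideanSpace ℝ (Fin D) × ℝ => φ ((fun k : Fin 3 → ℤ => C z k), z.2) :=
      hφ.comp ((continuous_pi hCcont).prodMk continuous_snd)
    have h1 : (fun z => φ ((fun k : Fin 3 → ℤ => (pmap z).1.1 (q, k)), (pmap z).2.1 q)) =ᵐ[m]
        fun z => (fun z' => φ ((fun k : Fin 3 → ℤ => C z' k), z'.2)) (Φ q z) :=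
      hae.mono fun z hz => by simp only [hpmap z hz, hqr]
    rw [integral_congr_ae h1, ← integral_map (hΦm q).aemeasurable hGc.aestronglyMeasurable,
      hΦinv q (by exact_mod_cast hq)]
  · -- DRIFT
    intro a ha c hc hcb q q' hq hqq'
    obtain ⟨ℓ, hℓa⟩ := hℓ a ha.integrable
    have hqr : (0 : ℝ) ≤ q := by exact_mod_cast hq
    have hqq'r : (q : ℝ) ≤ q' := by exact_mod_cast hqq'
    -- the defect observable
    set h : EuclideanSpace ℝ (Fin D) × ℝ → ℝ := fun z =>
      (∫ x, ⟪a x, θ • ∑ j, (V z).1 j • g j x⟫_ℝ) - c (fun k : Fin 3 → ℤ => C z k) with hh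
    have hh' : ∀ z, h z = ℓ (V z).1 - c (fun k : Fin 3 → ℤ => C z k) := fun z => by
      show (∫ x, ⟪a x, θ • ∑ j, (V z).1 j • g j x⟫_ℝ) - c (fun k : Fin 3 → ℤ => C z k) = _
      rw [hℓa]
    have hcC : Continuous fun z => c (fun k : Fin 3 → ℤ => C z k) := hc.comp (continuous_pi hCcont)
    have hhc : Continuous h := by
      rw [show h = fun z => ℓ (V z).1 - c (fun k : Fin 3 → ℤ => C z k) from funext hh']
      exact (ℓ.continuous.comp (continuous_fst.comp hV.continuous)).sub hcC
    -- the path functional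
    set F : ↥(pathSpace R L : Set (Path (Fin 3))) × ↥((Set.univ : Set ℚ).pi fun _ : ℚ => Set.Icc (0 : ℝ) b) → ℝ :=
      fun x => |(∑' k, (⟪mFourierCoeff (EuclideanSpace.complexify ∘ a) k, x.1.1 (q', k)⟫_ℂ).re) -
        (∑' k, (⟪mFourierCoeff (EuclideanSpace.complexify ∘ a) k, x.1.1 (q, k)⟫_ℂ).re) -
        ∫ τ in (q : ℝ)..q', c (fun k : Fin 3 → ℤ => pathExt x.1.1 τ k)| with hF
    have hpt : ∀ z ∈ Bx, F (pmap z) = |∫ τ in (q : ℝ)..q', h (Φ τ z)| := by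
      intro z hz
      have hS : ∀ r : ℚ, 0 ≤ r →
          (∑' k, (⟪mFourierCoeff (EuclideanSpace.complexify ∘ a) k, C (Φ ((max r 0 : ℚ) : ℝ) z) k⟫_ℂ).re) =
            ℓ (Φ r z).1 := fun r hr => by
        rw [max_eq_left hr, hC]
        exact (hpars a (ha.memLp 2) _).trans (hℓa _)
      have hE : ∫ τ in (q : ℝ)..q', c (fun k : Fin 3 → ℤ =>
          pathExt (fun p : ℚ × (Fin 3 → ℤ) => C (Φ ((max p.1 0 : ℚ) : ℝ) z) p.2) τ k) =
          ∫ τ in (q : ℝ)..q', c (fun k : Fin 3 → ℤ => C (Φ τ z) k) := by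
        refine intervalIntegral.integral_congr fun τ hτ => ?_
        rw [uIcc_of_le hqq'r] at hτ
        congr 1
        funext k
        exact pathExt_curvePath (hmem z hz) (hγcont z) (hqr.trans hτ.1) k
      have hFTC : ∫ τ in (q : ℝ)..q', ℓ (V (Φ τ z)).1 = ℓ (Φ q' z).1 - ℓ (Φ q z).1 := by
        have key := intervalIntegral.integral_eq_sub_of_hasDerivAt
          (f := fun τ => ℓ (Φ τ z).1) (f' := fun τ => ℓ (V (Φ τ z)).1) (a := (q : ℝ)) (b := (q' : ℝ))
          (fun τ _ => ℓ.hasFDerivAt.comp_hasDerivAt τ (hfst z τ))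
          ((ℓ.continuous.comp (continuous_fst.comp (hV.continuous.comp (hΦs z)))).intervalIntegrable _ _)
        exact key
      have hsplit : ∫ τ in (q : ℝ)..q', h (Φ τ z) =
          (ℓ (Φ q' z).1 - ℓ (Φ q z).1) - ∫ τ in (q : ℝ)..q', c (fun k : Fin 3 → ℤ => C (Φ τ z) k) := by
        simp_rw [hh']
        rw [intervalIntegral.integral_sub, hFTC]
        · exact (ℓ.continuous.comp (continuous_fst.comp (hV.continuous.comp (hΦs z)))).intervalIntegrable _ _
        · exact (hcC.comp (hΦs z)).intervalIntegrable _ _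
      rw [hpmap z hz]
      simp only [hF]
      rw [hS q' (hq.trans hqq'), hS q hq, hE, hsplit]
    have hRHS : 0 ≤ ((q' : ℝ) - q) * ∫ z, |h z| ∂m :=
      mul_nonneg (by linarith) (integral_nonneg fun _ => abs_nonneg _)
    by_cases hFm : AEStronglyMeasurable F (m.map pmap)
    · rw [integral_map hpmapm hFm]
      calc ∫ z, F (pmap z) ∂m = ∫ z, |∫ τ in (q : ℝ)..q', h (Φ τ z)| ∂m :=
            integral_congr_ae (hae.mono fun z hz => hpt z hz)
        _ ≤ ((q' : ℝ) - q) * ∫ z, |h z| ∂m := hΦL1 h hhc q q' hqr hqq'r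
    · rw [integral_non_aestronglyMeasurable hFm]
      exact hRHS
  · -- ENERGY
    intro K q q' hq hqq'
    obtain ⟨ℓ, hℓf⟩ := hℓ f hf.integrable
    have hqr : (0 : ℝ) ≤ q := by exact_mod_cast hq
    have hqq'r : (q : ℝ) ≤ q' := by exact_mod_cast hqq'
    -- the resolved dissipation and the work of the synthesized field
    have hDc : Continuous fun z : EuclideanSpace ℝ (Fin D) × ℝ =>
        ν * (4 * Real.pi ^ 2 * ∑ k ∈ freqBall K, freqNormSq k * ‖C z k‖ ^ 2) :=
      continuous_const.mul (continuous_const.mul (continuous_finsetSum _ fun k _ =>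
        continuous_const.mul (((hCcont k).norm).pow 2)))
    have hWc : Continuous fun z : EuclideanSpace ℝ (Fin D) × ℝ => ∫ x, ⟪f x, θ • ∑ j, z.1 j • g j x⟫_ℝ := by
      simp_rw [hℓf]
      exact ℓ.continuous.comp continuous_fst
    -- the defect observable
    set h : EuclideanSpace ℝ (Fin D) × ℝ → ℝ := fun z => (V z).2 +
      2 * (ν * (4 * Real.pi ^ 2 * ∑ k ∈ freqBall K, freqNormSq k * ‖C z k‖ ^ 2)) -
      2 * ∫ x, ⟪f x, θ • ∑ j, z.1 j • g j x⟫_ℝ with hh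
    have hhc : Continuous h :=
      ((continuous_snd.comp hV.continuous).add (continuous_const.mul hDc)).sub (continuous_const.mul hWc)
    have hhpc : Continuous fun z => max 0 (h z) := continuous_const.max hhc
    -- the path functional
    set F : ↥(pathSpace R L : Set (Path (Fin 3))) × ↥((Set.univ : Set ℚ).pi fun _ : ℚ => Set.Icc (0 : ℝ) b) → ℝ :=
      fun x => max 0 (x.2.1 q' - x.2.1 q + ∫ τ in (q : ℝ)..q',
        (2 * pathDiss ν K x.1.1 τ -
          2 * ∑' k, (⟪mFourierCoeff (EuclideanSpace.complexify ∘ f) k, pathExt x.1.1 τ k⟫_ℂ).re)) with hF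
    have hpt : ∀ z ∈ Bx, F (pmap z) ≤ |∫ τ in (q : ℝ)..q', max 0 (h (Φ τ z))| := by
      intro z hz
      have hq'r : ((max q' 0 : ℚ) : ℝ) = (q' : ℝ) := by rw [max_eq_left (hq.trans hqq')]
      have hqr' : ((max q 0 : ℚ) : ℝ) = (q : ℝ) := by rw [max_eq_left hq]
      -- the integrand along the orbit
      have hE : ∫ τ in (q : ℝ)..q',
          (2 * pathDiss ν K (fun p : ℚ × (Fin 3 → ℤ) => C (Φ ((max p.1 0 : ℚ) : ℝ) z) p.2) τ -
            2 * ∑' k, (⟪mFourierCoeff (EuclideanSpace.complexify ∘ f) k,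
              pathExt (fun p : ℚ × (Fin 3 → ℤ) => C (Φ ((max p.1 0 : ℚ) : ℝ) z) p.2) τ k⟫_ℂ).re) =
          ∫ τ in (q : ℝ)..q', (2 * (ν * (4 * Real.pi ^ 2 * ∑ k ∈ freqBall K, freqNormSq k * ‖C (Φ τ z) k‖ ^ 2)) -
            2 * ∫ x, ⟪f x, θ • ∑ j, (Φ τ z).1 j • g j x⟫_ℝ) := by
        refine intervalIntegral.integral_congr fun τ hτ => ?_
        rw [uIcc_of_le hqq'r] at hτ
        have hext : ∀ k, pathExt (fun p : ℚ × (Fin 3 → ℤ) => C (Φ ((max p.1 0 : ℚ) : ℝ) z) p.2) τ k = C (Φ τ z) k :=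
          fun k => pathExt_curvePath (hmem z hz) (hγcont z) (hqr.trans hτ.1) k
        simp only [pathDiss, hext]
        rw [hC]
        simp only
        rw [hpars f (hf.memLp 2)]
      have hFTC : ∫ τ in (q : ℝ)..q', (V (Φ τ z)).2 = (Φ q' z).2 - (Φ q z).2 := by
        have key := intervalIntegral.integral_eq_sub_of_hasDerivAt
          (f := fun τ => (Φ τ z).2) (f' := fun τ => (V (Φ τ z)).2) (a := (q : ℝ)) (b := (q' : ℝ))
          (fun τ _ => hsnd z τ) ((continuous_snd.comp (hV.continuous.comp (hΦs z))).intervalIntegrable _ _)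
        exact key
      have hsum : (Φ q' z).2 - (Φ q z).2 + ∫ τ in (q : ℝ)..q',
          (2 * (ν * (4 * Real.pi ^ 2 * ∑ k ∈ freqBall K, freqNormSq k * ‖C (Φ τ z) k‖ ^ 2)) -
            2 * ∫ x, ⟪f x, θ • ∑ j, (Φ τ z).1 j • g j x⟫_ℝ) = ∫ τ in (q : ℝ)..q', h (Φ τ z) := by
        have hi1 : IntervalIntegrable (fun τ => (V (Φ τ z)).2) volume (q : ℝ) q' :=
          (continuous_snd.comp (hV.continuous.comp (hΦs z))).intervalIntegrable _ _
        have hi2 : IntervalIntegrable (fun τ =>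
            2 * (ν * (4 * Real.pi ^ 2 * ∑ k ∈ freqBall K, freqNormSq k * ‖C (Φ τ z) k‖ ^ 2)) -
              2 * ∫ x, ⟪f x, θ • ∑ j, (Φ τ z).1 j • g j x⟫_ℝ) volume (q : ℝ) q' :=
          (((continuous_const.mul hDc).sub (continuous_const.mul hWc)).comp (hΦs z)).intervalIntegrable _ _
        rw [← hFTC, ← intervalIntegral.integral_add hi1 hi2]
        refine intervalIntegral.integral_congr fun τ _ => ?_
        simp only [hh]
        ring
      rw [hpmap z hz]
      simp only [hF]
      rw [hq'r, hqr', hE, hsum, abs_of_nonneg (intervalIntegral.integral_nonneg hqq'r fun _ _ => le_max_left _ _)]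
      exact max_intervalIntegral_le (hhc.comp (hΦs z)) hqq'r
    have habs : ∀ z, |max 0 (h z)| = max 0 (h z) := fun z => abs_of_nonneg (le_max_left _ _)
    have hRHS : 0 ≤ ((q' : ℝ) - q) * ∫ z, max 0 (h z) ∂m :=
      mul_nonneg (by linarith) (integral_nonneg fun _ => le_max_left _ _)
    by_cases hFm : AEStronglyMeasurable F (m.map pmap)
    · rw [integral_map hpmapm hFm]
      calc ∫ z, F (pmap z) ∂m ≤ ∫ z, |∫ τ in (q : ℝ)..q', max 0 (h (Φ τ z))| ∂m :=
            integral_mono_of_nonneg (Eventually.of_forall fun z => le_max_left _ _)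
              ((hΦint _ ((hΦpar _ hhpc _ _).abs))) (hae.mono fun z hz => hpt z hz)
        _ ≤ ((q' : ℝ) - q) * ∫ z, |max 0 (h z)| ∂m := hΦL1 _ hhpc q q' hqr hqq'r
        _ = ((q' : ℝ) - q) * ∫ z, max 0 (h z) ∂m := by simp_rw [habs]
    · rw [integral_non_aestronglyMeasurable hFm]
      exact hRHS

end Summit.AnomalousDissipation.AnomalousDissipation.Theorems.EnsembleRealization
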